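import Mathlib
import HarnessLib
import HarnessLib.Audit
import Summits.PneNP.Statement
import Literature.Computability.Complexity.Classes
import Literature.Computability.Complexity.Nondeterministic
import Literature.Computability.Complexity.TruthTableClosure
import Literature.Computability.Complexity.NPBridge
import Literature.Computability.Complexity.ClayProblem
import HarnessLib.Audit.Status.Attr

/-!
Route: Autoreducibility

DORMANT since 2026-08-27T14:56:49Z (reconciler: no traction for 9.8 d (last activity statement-checked at 2026-08-17T17:35:34Z); parked, not closed — `ledger route dormant route-PneNP-Autoreducibility --off` to reactivate) — unstaffed, not closed; items shared with open routes are served there. `ledger route dormant <id> --off` reactivates.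

# Route Autoreducibility — P ≠ NP from truth-table autoreducibility of EXP-complete sets (BFvMT
question 4, bridge proved in the 2001 archive)

It suffices to show X = ThreeTTCompleteAutoreducible: every set in EXP that is ≤ᵖ_{3-tt}-hard for
EXP is ≤ᵖ_{tt}-AUTOREDUCIBLE —
decidable in polynomial time with nonadaptive oracle queries to the set itself, none equal to the
input (Buhrman–Fortnow–van
Melkebeek–Torenvliet 2000, Fig. 7 question 4, in the 3-query form their diagonal sets have).
RESURRECT-2001: this is the earlier
programme's route exp-truth-table-autoreducibility (STATUS upheld, paper v7 refereed ×7, two Lean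
legs), whose closing step — in print
question 4 only gives NL ≠ NP / P ≠ PSPACE (Buhrman–Torenvliet 2005 table) — the archive PROVED: NP
⊆ QP ⇒ some ≤3-tt-complete set
for EXP is not ≤tt-autoreducible (its thm:A(i), cor:step3), so question 4 ⇒ NP ⊄ QP ⊇ P ≠ NP. The
deciding theorem uses the
SHARPENED crux TallyAutoreducible (correctness demanded only on tally inputs 0ⁿ, where the archive's
prop:onebit locates the whole
obstruction — the weakest sufficient form, so that proving either crux fires it) and the bridge as a
support item to be re-proved here;
X enters through the glue TallyOfFull. No card is realised; nearest cards
post-programme-complete-degrees, eexp-autoreducibility-dichotomy.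
Lean: `∀ A ∈ Literature.Computability.Complexity.EXP, (∀ K ∈
Literature.Computability.Complexity.EXP, ∃ Q ∈ Literature.Computability.Complexity.FP, ∃ D ∈
Literature.Computability.Complexity.Classes.P, K = Literature.Computability.Complexity.ttLang Q
(Polynomial.C 3) D A) → ∃ Q ∈ Literature.Computability.Complexity.FP, ∃ q : Polynomial ℕ, ∃ D ∈
Literature.Computability.Complexity.Classes.P, (∀ x : List Bool, ∀ i < q.eval x.length, Q
(Literature.Computability.Complexity.boolPair x (List.replicate i true)) ≠ x) ∧ A =
Literature.Computability.Complexity.ttLang Q q D A`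

## Assembly
Pure logic (sorry-free in Sketch.lean / glue.lean): if ¬PneNP then, through the proved model bridges
P_bool_eq_holds / np_bool_eq,
Nondeterministic.NP ⊆ Classes.P; TallyDiagonalBridge then yields a ≤3-tt-hard A ∈ EXP with no
tally-correct self-avoiding scheme,
contradicting TallyAutoreducible at A. The deciding theorem consumes the WEAKEST sufficient crux, so
the printed question closes the route
through the glue TallyOfFull (X → TallyAutoreducible; closes_via_threeTT in Sketch.lean is the
direct variant).

Rationale: WHY THIS LINE. Post's programme (BuhrmanEtAl2000; BuhrmanTorenvliet2005): separate classes by a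
STRUCTURAL property all complete sets of one class have
and some complete set of the other lacks — here autoreducibility, proved on the EXP side by
SIMULATION (local checkability of
computations, PCP: BuhrmanEtAl2000 Thm 4.1, 4.6) and denied on the P = NP side by DIAGONALIZATION;
the archive's theorems pin the
residue: unconditionally every ≤tt-complete set for EXP is 2-ROUND-tt-autoreducible (2001 thm:B) and
probabilistically
tt-autoreducible (BFvMT Thm 4.6), and under P = NP the diagonal set is autoreducible off the strings
0^{n_i} and everywhere with ONE
advice bit per length (2001 prop:onebit) — so the crux is a round-elimination / derandomization
statement for one algorithmic task, not a
lower bound, sandwiched PH = EXP ⇒ X ⇒ NP ⊄ QP (2001 cor:sandwich), hence informative either way (¬X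
⇒ PH ≠ EXP). Imported area:
structural complexity / computability (Post, Ladner autoreducibility); no route or negative of this
summit uses the structure of complete
degrees (44 open routes checked), and the archive settled what the hub card
eexp-autoreducibility-dichotomy left "to be checked".

RANKED CRUXES. #2 ThreeTTCompleteAutoreducible (crux) — every A ∈ EXP that is ≤ᵖ_{3-tt}-hard for EXP
(every K ∈ EXP is `ttLang Q (C 3) D A` for some Q ∈ FP, D ∈ P) has a polynomial-time nonadaptive
autoreduction: Q ∈ FP, q, D ∈ P with Q⟨x,1ⁱ⟩ ≠ x for i < q(|x|) and A = ttLang Q q D A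
(BuhrmanEtAl2000 Fig. 7 q.4, 3-query form; 2001 route exp-truth-table-autoreducibility Path step 1).
[difficulty: open-problem] (why it might fail: its only known sufficient condition is PH = EXP
(believed false); the BFvMT Lemma 3.5 diagonalization would refute it as soon as exponential-size
bounded-alternation QBFs can be decided in EXP without collapse; fails relative to every oracle with
NP ⊆ QP (2001 Thm A relativizes).) [BuhrmanEtAl2000, BuhrmanTorenvliet2005, GlaerEtAl2013,
NguyenSelman2016, ZhangYuanKan2016]
#3 TallyAutoreducible (crux) — every ≤ᵖ_{3-tt}-hard A ∈ EXP has a polynomial-time self-avoiding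
nonadaptive query scheme (Q ∈ FP, q, D ∈ P, Q⟨x,1ⁱ⟩ ≠ x) that decides membership correctly ON ALL
TALLY INPUTS 0ⁿ (the sharpened residue: by 2001 prop:onebit the P = NP diagonal set is autoreducible
off {0^{n_i}}, so the summit needs only this much of question 4). [difficulty: open-problem] (why it
might fail: it is exactly the one advice bit per length that no relativizing argument removes (2001
oracle W = pad(A₀): prob/2-round/1-bit/errorless-off-tally autoreducible, NOT tt-autoreducible);
under P = NP it is false by the bridge, so it is at least as hard to prove as P ≠ NP is true.)
[BuhrmanEtAl2000, BuhrmanTorenvliet2005, GlaerEtAl2007]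
#9 TallyDiagonalBridge (support) — if NP ⊆ P then some ≤ᵖ_{3-tt}-hard set in EXP has NO
polynomial-time self-avoiding nonadaptive query scheme correct on all tally inputs — the archive's
thm:A(i) (BFvMT Lemma 3.5 stage-wise diagonalization with two coding regions; membership in EXP from
P = NP via the time half of BFvMT Lemma 5.2: size-t, α-alternation QBFs in time t^{O(c^α)}) combined
with its prop:onebit (the diagonal set IS autoreducible off {0^{n_i}}, so a tally-correct scheme
would patch into a full autoreduction); the natural first landing is the plain form 'NP ⊆ P ⇒ some
≤3-tt-hard set in EXP is not ≤tt-autoreducible' as a --supports lemma, which with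
ThreeTTCompleteAutoreducible already banks 'question 4 ⇒ P ≠ NP'. Adapt
run/shared/lean/archive/2001/summits/pnp/routes/exp-truth-table-autoreducibility/paper/paper.tex (v7
8695a0cc) §§3–4; never copy. [difficulty: XL] [BuhrmanEtAl2000, BuhrmanTorenvliet2005]
#9 TallyOfFull (support) — glue, elementary: a full nonadaptive autoreduction is in particular
correct on tally inputs, so ThreeTTCompleteAutoreducible → TallyAutoreducible (proved in the
planner's Sketch.lean, 4 lines). [difficulty: provable-now] [BuhrmanEtAl2000]

TWO-LAYER PLAN. Foreseen glued splits once a crux moves (nothing filed now):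
ThreeTTCompleteAutoreducible ⇐ TwoRoundAutoreducible (2001 thm:B: every
≤tt-complete set for EXP is 2-round-tt-autoreducible — re-prove here as the k = 2 child) →
RoundElimination (2 rounds → 1 for ≤3-tt-hard
sets) → X; TallyAutoreducible ⇐ OneBitAdvice (P-uniform family of schemes correct with one advice
bit per length, 2001 prop:onebit /
H_IW form) → AdviceRemovalOnTally → TallyAutoreducible; the archive's untried WALL-REQUEST W(a,a′)
(one-round autoreductions in time
2^{n^{a′}}·n^r with polynomial reach, a′ < a, for ≤3-tt-hard sets in DTIME(2^{n^a}), with its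
claim-level bridge "P = NP ⇒ ¬W") is the
third foreseen child, to be typed with time charged to |x| (see Not decomposed yet). The ADAPTIVE
row one exponential up (every ≤ᵖ_{2-T}-hard set for EEXP is Turing autoreducible; bridge = 2001
thm:A(ii)) is typed in Sketch.lean (EEXPTwoTuringAutoreducible / EEXPDiagonalBridge /
closes_via_eexp) but is a SEPARATE thesis — the plancard of card eexp-autoreducibility-dichotomy —
not an item here.

KILL CRITERIA. ¬ThreeTTCompleteAutoreducible proved (a ≤3-tt-complete set for EXP with no
nonadaptive autoreduction, constructed without collapse
hypotheses) closes the route `refuted:ThreeTTCompleteAutoreducible` — and banks PH ≠ EXP (BFvMT Thm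
4.4 sandwich) as consolation;
¬TallyAutoreducible (hence ¬X) forces the pivot to the adaptive EEXP row (sibling thesis) or to
W(a,a′); a proof that TallyDiagonalBridge fails in
this machine model (e.g. no ≤3-tt-complete set for EXP is expressible with `ttLang`) is a typing
kill — restate over a repaired completeness
notion. ThreeTTCompleteAutoreducible proved elsewhere closes the route through TallyOfFull.

NOT DECOMPOSED YET. The 2-round theorem (2001 thm:B), the one-advice-bit and errorless-off-sparse
forms (2001 prop:onebit, thm:density), and the
subexponential one-round wall W(a,a′) are NOT items at open: the first three are layer-2 children
(Two-layer plan); W(a,a′) needs a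
time-bounded autoreduction notion whose budget is charged to |x| rather than to the padded query
index ⟨x,1ⁱ⟩ (with FTIME on the padded
input the statement trivialises: enough queries buy enough time to decide A outright) — a definition
request, then `workitem add`.
Constants 3 (queries) and 2 (adaptive queries) are BFvMT's diagonal-set parameters, the weakest the
bridges support; no regime split.

CHEAPEST FALSIFIER. A citation-index sweep of the ~60 papers citing BuhrmanEtAl2000 for a settlement
of Fig. 7 question 4 (EXP, ≤tt) or of the EEXP ≤2-T
row since 2005: the archive's referees ran 6 targeted web queries (none found; nearest:
ZhangYuanKan2016 probabilistic autoreductions,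
GlaerEtAl2013, NguyenSelman2016 — all NP/NEXP or other reductions); this seat re-ran
arXiv/zbMATH/Crossref (14 + 12 hits, same
picture) and filed acq-06244 for Nguyen–Selman STACS 2014. Second: a two-page model check that a
≤3-tt-complete set for EXP exists
with `ttLang`/`FP` as defined (else the bridges are unprovable as typed).

NUMBERS. Known for ≤tt-complete A for EXP: probabilistically tt-autoreducible (BuhrmanEtAl2000 Thm
4.6); 2-round tt-autoreducible (2001 thm:B,
refereed); every ≤2-tt-complete set 2-tt-autoreducible (BFvMT Thm 4.5); under P = NP: some
≤3-tt-complete A ∈ DTIME(2^{n³}) not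
tt-autoreducible (2001 thm:A(i)), failures ≥ 1 at infinitely many lengths and ≤ k per length for
≤k-tt-complete sets (2001 prop:kexc),
autoreducible with exactly 1 advice bit/length (2001 prop:onebit); errorless off ≤ 2ⁿ/n^c strings
unconditionally (2001 thm:density).
In print the yes-branch gives NL ≠ NP and P ≠ PSPACE (BuhrmanTorenvliet2005 table); the archive's
yes ⇒ NP ⊄ QP. Items at open: 5.

DEFINITION REQUESTS. Wanted in Literature/Computability/Complexity (filed after open):
`IsPolyTTReducible k K A` / `IsPolyTTHard C A` (bounded and unbounded
nonadaptive reducibility over `ttLang`), `IsTTAutoreducible A`, `IsTuringAutoreducible A` (over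
`OracleAlg`, for the sibling EEXP row), `EEXP`; and a
time-charged-to-|x| autoreduction notion for W(a,a′). Cite facts wanted: BuhrmanEtAl2000 Thms 4.1,
4.4, 4.5, 4.6, Lemma 3.4/3.5 as named
facts (statement only).

Novelty: Searches (2026-08-16): `lit search --source arxiv "autoreducibility complete sets"` (2:
arXiv:1601.05494, arXiv:math/9807185); `lit search
--source zbmath "autoreducible complete sets"` (14: BFvMT00, GlaerEtAl2007, GlaerEtAl2013,
NguyenSelman2016, ZhangYuanKan2016, Glaßer–Witek
2017 …); `lit search --source crossref "autoreducibility complete sets nonadaptive"` (12;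
Hitchcock–Shafei 2017, GNRSW13); local index /
OpenAlex / S2 unavailable this session (searchd reset; 429); hub: 44 open PneNP routes (none
structural), cards post-programme-complete-degrees
(known), eexp-autoreducibility-dichotomy (variant); archive: routes exp-truth-table-autoreducibility
(v7 upheld + reviews), nexp-complete-sets-not-autoreducible, literature INDEX rows for BFvMT00 /
BT05.
Nearest prior art found: BuhrmanEtAl2000 (doi:10.1137/s0097539798334736) Fig. 7 q.4 with
BuhrmanTorenvliet2005's table (yes ⇒ NL ≠ NP, P ≠ PSPACE; no ⇒ PH ≠ EXP); in-hub card
eexp-autoreducibility-dichotomy (EEXP adaptive row, sharpening unverified).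
Delta: the yes-branch is re-priced at P ≠ NP by a bridge the 2001 archive proved and refereed
(question 4 ⇒ NP ⊄ QP), and the crux is cut down to its tally/one-bit residue with the 2-round
theorem beneath it — typed here over the tree's `ttLang`/`OracleAlg` so provers can bank the bridge.
Claimed grade: variant  [refs: 10.1137/s0097539798334736, 1601.05494, math/9807185, doi:10.1137/s0097539798334736, GlaerEtAl2007, GlaerEtAl2013, NguyenSelman2016, ZhangYuanKan2016, BuhrmanEtAl2000, BuhrmanTorenvliet2005]

Barriers (technique_class: autoreducibility, structural-complexity, round-elimination): - technique_class: autoreducibility, structural-complexity, round-elimination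
- Literature.Barriers.PneNP.Relativization: APPLIES and is met head-on: X ⇒ P ≠ NP forces a
non-relativizing proof, and the archive shows question 4 is INDEPENDENT of relativization (holds
relative to H with NP^H = EXP^H since BFvMT Thm 4.4 relativizes; fails relative to every O with NP^O
⊆ QP^O); the positive technique class (local checkability of EXP computations through the complete
set, PCP) is exactly the known non-relativizing ingredient (BFvMT Thm 4.1 vs their oracle Thm 4.2) —
the bet is that it also removes the second nonadaptive round.
- Literature.Barriers.PneNP.BoundedRelativization: same status; the archive's [poly]-query-model
oracle (2-round theorem holds relative to every O, question 4 fails relative to some O) says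
bounded-query relativizing arguments cannot finish either.
- Literature.Barriers.PneNP.Algebrization: the archive's certificate Thm 3.1/Cor 3.3 algebrize
(AW-style Õ); BFvMT's probabilistic autoreductions use PCP/MIP, which algebrize — so the
coin-removal must be non-algebrizing too; conceded, no named evasion beyond "uniform, white-box use
of the reduction's own structure".
- Literature.Barriers.PneNP.NaturalProofs: does not apply — a uniform structural statement about
complete sets, no property of truth tables; BFvMT §4.3 note their negative results fail
non-uniformly, i.e. the method lives on uniformity.
- Negatives index: 5 refuted PneNP statements at filing (Lyapunov

History (route lifecycle, newest last):
- 2026-08-27T14:56:49Z · DORMANT — reconciler: no traction for 9.8 d (last activity statement-checked at 2026-08-17T17:35:34Z); parked, not closed — `ledger route dormant route-PneNP-Autoreducibi (operator:999:1210157)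

sub-problem: PneNP · status: dormant · opened planner-plan-lens-PneNP-resurrect2001-v2-n1-0 2026-08-16T16:56:58Z · rev 1 · ledger route-PneNP-Autoreducibility
GENERATED by the gate from the ledger (D-0016/17). Provers cite these decls: `theorem foo : Summit.PneNP.PneNP.Theses.Autoreducibility.<Decl> := …` in Summits/PneNP/PneNP/Theorems/<Name>.lean.
-/

namespace Summit.PneNP.PneNP.Theses.Autoreducibility

open scoped BigOperators Topology Manifold Classical MeasureTheory ProbabilityTheory Matrix InnerProductSpace ComplexConjugate ContinuousMap
open Filter Set Function TopologicalSpace MeasureTheory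

attribute [summit_statement] _root_.PneNP

open Literature.PNP

/-- item stmt-PneNP-15946 · crux · rank 2 · open · by planner
why it might fail: its only known sufficient condition is PH = EXP (believed false); the BFvMT Lemma 3.5 diagonalization would refute it as soon as exponential-size bounded-alternation QBFs can be decided in EXP without collapse; fails relative to every oracle with NP ⊆ QP (2001 Thm A relativizes).
sources: BuhrmanEtAl2000, BuhrmanTorenvliet2005, GlaerEtAl2013, NguyenSelman2016, ZhangYuanKan2016
[crux] every A ∈ EXP that is ≤ᵖ_{3-tt}-hard for EXP (every K ∈ EXP is `ttLang Q (C 3) D A` for some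
Q ∈ FP, D ∈ P) has a polynomial-time nonadaptive autoreduction: Q ∈ FP, q, D ∈ P with Q⟨x,1ⁱ⟩ ≠ x
for i < q(|x|) and A = ttLang Q q D A (BuhrmanEtAl2000 Fig. 7 q.4, 3-query form; 2001 route
exp-truth-table-autoreducibility Path step 1). [difficulty: open-problem] -/
@[route_item "route-PneNP-Autoreducibility"]
def ThreeTTCompleteAutoreducible : Prop :=
  ∀ A ∈ Literature.Computability.Complexity.EXP, (∀ K ∈ Literature.Computability.Complexity.EXP, ∃ Q ∈ Literature.Computability.Complexity.FP, ∃ D ∈ Literature.Computability.Complexity.Classes.P, K = Literature.Computability.Complexity.ttLang Q (Polynomial.C 3) D A) → ∃ Q ∈ Literature.Computability.Complexity.FP, ∃ q : Polynomial ℕ, ∃ D ∈ Literature.Computability.Complexity.Classes.P, (∀ x : List Bool, ∀ i < q.eval x.length, Q (Literature.Computability.Complexity.boolPair x (List.replicate i true)) ≠ x) ∧ A = Literature.Computability.Complexity.ttLang Q q D A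

/-- item stmt-PneNP-15947 · crux · rank 3 · open · by planner
why it might fail: it is exactly the one advice bit per length that no relativizing argument removes (2001 oracle W = pad(A₀): prob/2-round/1-bit/errorless-off-tally autoreducible, NOT tt-autoreducible); under P = NP it is false by the bridge, so it is at least as hard to prove as P ≠ NP is true.
sources: BuhrmanEtAl2000, BuhrmanTorenvliet2005, GlaerEtAl2007
[crux] every ≤ᵖ_{3-tt}-hard A ∈ EXP has a polynomial-time self-avoiding nonadaptive query scheme (Q
∈ FP, q, D ∈ P, Q⟨x,1ⁱ⟩ ≠ x) that decides membership correctly ON ALL TALLY INPUTS 0ⁿ (the sharpened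
residue: by 2001 prop:onebit the P = NP diagonal set is autoreducible off {0^{n_i}}, so the summit
needs only this much of question 4). [difficulty: open-problem] -/
@[route_item "route-PneNP-Autoreducibility", crux]
def TallyAutoreducible : Prop :=
  ∀ A ∈ Literature.Computability.Complexity.EXP, (∀ K ∈ Literature.Computability.Complexity.EXP, ∃ Q ∈ Literature.Computability.Complexity.FP, ∃ D ∈ Literature.Computability.Complexity.Classes.P, K = Literature.Computability.Complexity.ttLang Q (Polynomial.C 3) D A) → ∃ Q ∈ Literature.Computability.Complexity.FP, ∃ q : Polynomial ℕ, ∃ D ∈ Literature.Computability.Complexity.Classes.P, (∀ x : List Bool, ∀ i < q.eval x.length, Q (Literature.Computability.Complexity.boolPair x (List.replicate i true)) ≠ x) ∧ ∀ n : ℕ, (List.replicate n false ∈ A ↔ List.replicate n false ∈ Literature.Computability.Complexity.ttLang Q q D A)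

/-- item stmt-PneNP-15948 · crux · rank 9 · open · by planner
why it might fail: the archive's thm:A(i)/prop:onebit are AI-refereed only; the tally patch and the exactly-3-query ttLang completeness format are this seat's re-typing; EXP-membership of the diagonal set needs the P = NP bound t^{O(c^α)} for log-alternation QBFs to stay inside 2^{poly} in THIS machine model.
sources: BuhrmanEtAl2000, BuhrmanTorenvliet2005
[support] if NP ⊆ P then some ≤ᵖ_{3-tt}-hard set in EXP has NO polynomial-time self-avoiding
nonadaptive query scheme correct on all tally inputs — the archive's thm:A(i) (BFvMT Lemma 3.5
stage-wise diagonalization with two coding regions; membership in EXP from P = NP via the time half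
of BFvMT Lemma 5.2: size-t, α-alternation QBFs in time t^{O(c^α)}) combined with its prop:onebit
(the diagonal set IS autoreducible off {0^{n_i}}, so a tally-correct scheme would patch into a full
autoreduction); the natural first landing is the plain form 'NP ⊆ P ⇒ some ≤3-tt-hard set in EXP is
not ≤tt-autoreducible' as a --supports lemma, which with ThreeTTCompleteAutoreducible already banks
'question 4 ⇒ P ≠ NP'. Adapt
run/shared/lean/archive/2001/summits/pnp/routes/exp-truth-table-autoreducibility/paper/paper.tex (v7
8695a0cc) §§3–4; never copy. [difficulty: XL] -/
@[route_item "route-PneNP-Autoreducibility", crux]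
def TallyDiagonalBridge : Prop :=
  Literature.Computability.Complexity.Nondeterministic.NP ⊆ Literature.Computability.Complexity.Classes.P → ∃ A ∈ Literature.Computability.Complexity.EXP, (∀ K ∈ Literature.Computability.Complexity.EXP, ∃ Q ∈ Literature.Computability.Complexity.FP, ∃ D ∈ Literature.Computability.Complexity.Classes.P, K = Literature.Computability.Complexity.ttLang Q (Polynomial.C 3) D A) ∧ ¬ ∃ Q ∈ Literature.Computability.Complexity.FP, ∃ q : Polynomial ℕ, ∃ D ∈ Literature.Computability.Complexity.Classes.P, (∀ x : List Bool, ∀ i < q.eval x.length, Q (Literature.Computability.Complexity.boolPair x (List.replicate i true)) ≠ x) ∧ ∀ n : ℕ, (List.replicate n false ∈ A ↔ List.replicate n false ∈ Literature.Computability.Complexity.ttLang Q q D A)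

-- item stmt-PneNP-15975 · support · rank 5 · open · by planner — informal only, no Lean statement yet:
--   [crux] The 2001 archive untried WALL-REQUEST W(a,a′) (route exp-truth-table-autoreducibility,
--   2026-08-08 16:04, seat pivoted here when it stopped): ∃ a > 2, a′ < a, r such that every
--   ≤ᵖ_{3-tt}-hard set for EXP lying in DTIME(2^{n^a}) is ONE-ROUND nonadaptively autoreducible by a
--   self-avoiding scheme whose query generator and evaluator run in time 2^{n^{a′}}·n^r CHARGED TO |x|
--   and whose queries have length ≤ n^r (weaker demand than polynomial time: implied by
--   ThreeTTCompleteAutoreducible). Sufficient for the summit by the archive claim-level finer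
--   diagonalization "P = NP ⇒ for all a > 2, a′ < a

/-- item stmt-PneNP-15949 · support · rank 9 · closed · proved by Summit.PneNP.PneNP.Theorems.autoreducibility_tallyOfFull_proof @ 1c7d0e25189d (prover) · by planner
sources: BuhrmanEtAl2000
[support] glue, elementary: a full nonadaptive autoreduction is in particular correct on tally
inputs, so ThreeTTCompleteAutoreducible → TallyAutoreducible (proved in the planner's Sketch.lean, 4
lines). [difficulty: provable-now] -/
@[route_item "route-PneNP-Autoreducibility"]
def TallyOfFull : Prop :=
  ThreeTTCompleteAutoreducible → TallyAutoreducible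

-- `TallyOfFull` holds: proved by `Summit.PneNP.PneNP.Theorems.autoreducibility_tallyOfFull_proof` @ 1c7d0e25189d (its module imports this route file, so no `_holds` link can be stated here).

/-- item stmt-PneNP-15950 · assembly · rank 1 · closed · proved by Summit.PneNP.PneNP.Theorems.autoreducibility_assembly_proof @ 5d49ad13aa82 (prover) · by planner
sources: BuhrmanEtAl2000, BuhrmanTorenvliet2005
[assembly] TallyAutoreducible → TallyDiagonalBridge → PneNP (deciding theorem `closes`); and
ThreeTTCompleteAutoreducible → TallyOfFull → TallyAutoreducible. -/
@[route_item "route-PneNP-Autoreducibility"]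
def Assembly : Prop :=
  TallyAutoreducible → TallyDiagonalBridge → _root_.PneNP

-- `Assembly` holds: proved by `Summit.PneNP.PneNP.Theorems.autoreducibility_assembly_proof` @ 5d49ad13aa82 (its module imports this route file, so no `_holds` link can be stated here).

/-! D-0027 §2.1 — DECIDING THEOREM (planner-authored via `route open/edit --closes-file`; by planner-plan-lens-PneNP-resurrect2001-v2-n1-0 2026-08-16T16:56:58Z):
its hypotheses are this route's items and its conclusion the sub-problem Statement (glue_lint), and it elaborates with this file. -/

@[closes "route-PneNP-Autoreducibility"] theorem closes (hT : TallyAutoreducible) (hB : TallyDiagonalBridge) : _root_.PneNP := by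
  classical
  unfold TallyAutoreducible at hT
  unfold TallyDiagonalBridge at hB
  have hNP : ¬ (Literature.Computability.Complexity.Nondeterministic.NP ⊆
      Literature.Computability.Complexity.Classes.P) := by
    intro hsub
    obtain ⟨A, hA, hhard, hno⟩ := hB hsub
    exact hno (hT A hA hhard)
  have hP : Literature.Computability.Complexity.PNPWave0.P Bool =
      Literature.Computability.Complexity.Classes.P :=
    Literature.Computability.Complexity.P_bool_eq_holds
  have hN : Literature.Computability.Complexity.PNPWave0.NP Bool =
      Literature.Computability.Complexity.Nondeterministic.NP :=
    Literature.Computability.Complexity.np_bool_eq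
  show ∃ L : Language Bool, L ∈ Literature.Computability.Complexity.PNPWave0.NP Bool ∧
      L ∉ Literature.Computability.Complexity.PNPWave0.P Bool
  rw [hP, hN]
  simpa only [Set.not_subset] using hNP

end Summit.PneNP.PneNP.Theses.Autoreducibility
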